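import Summits.RiemannHypothesis.RiemannHypothesis.Theorems.OddSectorOddBartaFloorOddPolarDefect
import Summits.RiemannHypothesis.RiemannHypothesis.Theorems.OddSectorOddBartaFloorPhiDerivSmooth
import Summits.RiemannHypothesis.RiemannHypothesis.Theorems.OddSectorOddBartaFloorThetaApproximants
import Summits.RiemannHypothesis.RiemannHypothesis.Theorems.OddSectorOddBartaFloorEnergyBound
import Summits.RiemannHypothesis.RiemannHypothesis.Theorems.OddSectorOddBartaFloorPolarContinuity
import Summits.RiemannHypothesis.RiemannHypothesis.Theorems.WeilGroundStateGroundStatesConvergeToXiEulerLagrange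
import Literature.NumberTheory.LFunctions.WeilOddGroundState
import HarnessLib

/-!
# Crux `OddSector.OddBartaFloor`, line `Sketch`: the weak Euler–Lagrange identity against the BV probe

Assembly lemma `stub_asmEulerLagrange` of the lead's skeleton (crux item stmt-RiemannHypothesis-17779,
route `RiemannHypothesis/OddSector`). Along an `L²`-normalised minimising sequence `gₙ` of ODD window
tests (`Re Q(gₙ) → ε_od(a)`) converging in `L²` to `u`, the polarised Weil functional against the
discontinuous odd theta probe `H_a = weilOddThetaVector a` converges:

  `W(gₙ ⋆ H̃_a) → ε_od(a) · ∫ u H_a`.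

Proof (discriminant route, no form domain, no operator): the odd Cauchy–Schwarz bound
`|Re(W(g⋆h̃) + W(h⋆g̃)) − 2ε_od Re⟨g,h⟩| ≤ 2√q(g)√q(h)` (`stub_oddPolarDefect`) is applied to `g = gₙ`
and to smooth odd cut-off approximants `h = hₘ → H_a` (`stub_thetaApproximants`, smoothness of `Φ′`
from `stub_phiDerivSmooth`) whose shifted energies `q(hₘ)` are bounded uniformly (`stub_energyBound`
via the Markov decomposition); letting `m → ∞` FIRST at fixed `n` (`stub_polarContinuity`:
`W(gₙ ⋆ h̃ₘ) → W(gₙ ⋆ H̃_a)`; hermitian symmetry for the swapped term; dominated convergence for the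
pairing), then the same with `i hₘ`, gives `‖W(gₙ ⋆ H̃_a) − ε_od ∫ gₙ H_a‖ ≤ 4√q(gₙ)√K → 0`, and
`∫ gₙ H_a → ∫ u H_a` in `L²`.
-/

set_option linter.dupNamespace false

noncomputable section

open Set MeasureTheory Filter Complex
open scoped Real Topology ComplexConjugate ENNReal

namespace Summit.RiemannHypothesis.RiemannHypothesis.Theorems.OddBartaFloor

open Literature.NumberTheory.LFunctions
open Summit.RiemannHypothesis.RiemannHypothesis.Theorems.GroundStatesConvergeToXi

/-- **The polar defect against a BV limit probe.** Let `f` be an odd window test, `F` a bounded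
measurable probe vanishing off the window, and `hₘ → F` a.e. a dominated sequence of odd window tests
with shifted energies `q(hₘ) ≤ K`. Then
`|Re(W(f ⋆ F̃) + conj W(f ⋆ F̃)) − 2ε_od Re ∫ f F̄| ≤ 2√q(f)·√K`
(Cauchy–Schwarz for each `m`, then `m → ∞`: continuity of the polarised functional, hermitian symmetry,
dominated convergence of the pairing). -/
theorem abs_polarDefect_limit_le {a B K : ℝ} {f F : ℝ → ℂ} {h : ℕ → ℝ → ℂ}
    (hf : IsWeilTest f) (hfs : tsupport f ⊆ Icc (-a) a) (hfo : ∀ t, f (-t) = -f t)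
    (hFm : Measurable F) (hFB : ∀ t, ‖F t‖ ≤ B) (hF0 : ∀ t, t ∉ Icc (-a) a → F t = 0)
    (hh : ∀ m, IsWeilTest (h m) ∧ tsupport (h m) ⊆ Icc (-a) a ∧ (∀ t, h m (-t) = -h m t))
    (hhB : ∀ m t, ‖h m t‖ ≤ B)
    (hq : ∀ m, (weilQuadratic (h m)).re - weilOddGroundEnergy a * ∫ t, ‖h m t‖ ^ 2 ≤ K)
    (hlim : ∀ᵐ t : ℝ, Tendsto (fun m => h m t) atTop (𝓝 (F t))) :
    |(weilFunctional (weilConv f (weilReflect F)) +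
          conj (weilFunctional (weilConv f (weilReflect F)))).re -
        2 * weilOddGroundEnergy a * (∫ t, f t * conj (F t)).re| ≤
      2 * Real.sqrt ((weilQuadratic f).re - weilOddGroundEnergy a * ∫ t, ‖f t‖ ^ 2) * Real.sqrt K := by
  set ε := weilOddGroundEnergy a with hε
  set qf : ℝ := (weilQuadratic f).re - ε * ∫ t, ‖f t‖ ^ 2 with hqf
  -- the defect along the approximants and its bound
  set D : ℕ → ℝ := fun m => (weilFunctional (weilConv f (weilReflect (h m))) +
      weilFunctional (weilConv (h m) (weilReflect f))).re - 2 * ε * (∫ t, f t * conj (h m t)).re with hD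
  have hK0 : 0 ≤ K := le_trans (oddShiftedForm_nonneg (hh 0).1 (hh 0).2.1 (hh 0).2.2) (hq 0)
  have hbound : ∀ m, |D m| ≤ 2 * Real.sqrt qf * Real.sqrt K := fun m => by
    have h1 := stub_oddPolarDefect a f (h m) hf hfs hfo (hh m).1 (hh m).2.1 (hh m).2.2
    refine h1.trans ?_
    have h2 : Real.sqrt ((weilQuadratic (h m)).re - ε * ∫ t, ‖h m t‖ ^ 2) ≤ Real.sqrt K :=
      Real.sqrt_le_sqrt (hq m)
    have h3 : 0 ≤ 2 * Real.sqrt qf := by positivity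
    exact mul_le_mul_of_nonneg_left h2 h3
  -- the limit of the defect
  have hW : Tendsto (fun m => weilFunctional (weilConv f (weilReflect (h m)))) atTop
      (𝓝 (weilFunctional (weilConv f (weilReflect F)))) :=
    stub_polarContinuity a B f F h hf hFm hFB hF0 (fun m => ⟨(hh m).1, (hh m).2.1⟩) hhB hlim
  have hWs : Tendsto (fun m => weilFunctional (weilConv (h m) (weilReflect f))) atTop
      (𝓝 (conj (weilFunctional (weilConv f (weilReflect F))))) := by
    have h1 := (Complex.continuous_conj.tendsto _).comp hW
    refine h1.congr fun m => ?_
    simp only [Function.comp_apply]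
    exact (weilFunctional_weilConv_weilReflect_swap f (h m)).symm
  have hP : Tendsto (fun m => ∫ t, f t * conj (h m t)) atTop (𝓝 (∫ t, f t * conj (F t))) := by
    have hfi : Integrable f := hf.1.continuous.integrable_of_hasCompactSupport hf.2
    refine tendsto_integral_of_dominated_convergence (fun t => B * ‖f t‖) ?_ (hfi.norm.const_mul B) ?_ ?_
    · intro m
      exact (hf.1.continuous.mul (Complex.continuous_conj.comp (hh m).1.1.continuous)).aestronglyMeasurable
    · intro m
      refine Eventually.of_forall fun t => ?_
      rw [norm_mul, Complex.norm_conj, mul_comm]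
      exact mul_le_mul_of_nonneg_right (hhB m t) (norm_nonneg _)
    · filter_upwards [hlim] with t ht
      exact tendsto_const_nhds.mul ((Complex.continuous_conj.tendsto _).comp ht)
  have hDlim : Tendsto D atTop (𝓝 ((weilFunctional (weilConv f (weilReflect F)) +
      conj (weilFunctional (weilConv f (weilReflect F)))).re - 2 * ε * (∫ t, f t * conj (F t)).re)) := by
    have h1 := (Complex.continuous_re.tendsto _).comp (hW.add hWs)
    have h2 := (Complex.continuous_re.tendsto _).comp hP
    have h3 := h1.sub (h2.const_mul (2 * ε))
    exact h3
  have habs := (continuous_abs.tendsto _).comp hDlim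
  exact le_of_tendsto' habs hbound

/-- **Weak Euler–Lagrange identity against the BV probe `H_a`** (assembly lemma
`stub_asmEulerLagrange` of the skeleton): along an `L²`-normalised minimising sequence of odd window
tests `gₙ → u` in `L²` with `Re Q(gₙ) → ε_od(a)`,
`W(gₙ ⋆ H̃_a) → ε_od(a) ∫ u H_a`. -/
theorem stub_asmEulerLagrange :
    ∀ (a : ℝ) (u : ℝ → ℂ) (g : ℕ → ℝ → ℂ), 0 < a →
      (∀ n, IsWeilTest (g n) ∧ tsupport (g n) ⊆ Icc (-a) a ∧ (∀ t, g n (-t) = -g n t) ∧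
        ∫ t, ‖g n t‖ ^ 2 = (1 : ℝ)) →
      Tendsto (fun n => (weilQuadratic (g n)).re) atTop (𝓝 (weilOddGroundEnergy a)) →
      MemLp u 2 volume → Tendsto (fun n => ∫ t, ‖g n t - u t‖ ^ 2) atTop (𝓝 0) →
      Tendsto (fun n => weilFunctional (weilConv (g n)
          (weilReflect fun t => ((weilOddThetaVector a t : ℝ) : ℂ)))) atTop
        (𝓝 ((weilOddGroundEnergy a : ℂ) * ∫ t, u t * ((weilOddThetaVector a t : ℝ) : ℂ))) := by
  intro a u g ha hg hQ hu hL
  set ε := weilOddGroundEnergy a with hε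
  set Hc : ℝ → ℂ := fun t => ((weilOddThetaVector a t : ℝ) : ℂ) with hHc
  -- the approximants and their uniform bounds
  obtain ⟨K₁, h, hh, hinc, hdom, hconv⟩ := stub_thetaApproximants stub_phiDerivSmooth a ha
  obtain ⟨B, hB0, hB⟩ := exists_abs_weilOddThetaVector_le a
  obtain ⟨K₂, hK₂⟩ := stub_energyBound a B K₁ ha
  have hhB : ∀ m t, ‖h m t‖ ≤ B := fun m t => (hdom m t).trans (hB t)
  have hQm : ∀ m, (weilQuadratic (h m)).re ≤ K₂ := fun m =>
    hK₂ (h m) (hh m).1 (hh m).2.1 (hhB m) (hinc m)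
  -- `∫ ‖hₘ‖² ≤ 2aB²`, hence `q(hₘ) ≤ K₃`
  have hnorm : ∀ m, ∫ t, ‖h m t‖ ^ 2 ≤ 2 * a * B ^ 2 := fun m => by
    have hle : ∀ t, ‖h m t‖ ^ 2 ≤ (Icc (-a) a).indicator (fun _ => B ^ 2) t := fun t => by
      by_cases ht : t ∈ Icc (-a) a
      · rw [indicator_of_mem ht]
        exact pow_le_pow_left₀ (norm_nonneg _) (hhB m t) 2
      · rw [indicator_of_notMem ht]
        have h0 : h m t = 0 := by
          have := hdom m t
          rw [weilOddThetaVector_of_not_mem ht, abs_zero] at this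
          exact norm_le_zero_iff.1 this
        simp [h0]
    calc ∫ t, ‖h m t‖ ^ 2 ≤ ∫ t, (Icc (-a) a).indicator (fun _ => B ^ 2) t :=
          integral_mono (hh m).1.integrable_norm_sq
            ((integrable_indicator_iff measurableSet_Icc).2 (integrableOn_const (by simp))) hle
      _ = 2 * a * B ^ 2 := by
          rw [integral_indicator measurableSet_Icc, setIntegral_const]
          simp only [Real.volume_real_Icc_of_le (by linarith : -a ≤ a), smul_eq_mul]
          ring
  set K₃ : ℝ := K₂ + |ε| * (2 * a * B ^ 2) with hK₃
  have hq : ∀ m, (weilQuadratic (h m)).re - ε * ∫ t, ‖h m t‖ ^ 2 ≤ K₃ := fun m => by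
    have h1 : -(ε * ∫ t, ‖h m t‖ ^ 2) ≤ |ε| * (2 * a * B ^ 2) := by
      have h2 : |ε * ∫ t, ‖h m t‖ ^ 2| ≤ |ε| * (2 * a * B ^ 2) := by
        rw [abs_mul, abs_of_nonneg (integral_nonneg fun _ => by positivity)]
        exact mul_le_mul_of_nonneg_left (hnorm m) (abs_nonneg _)
      linarith [neg_abs_le (ε * ∫ t, ‖h m t‖ ^ 2)]
    linarith [hQm m]
  -- the probe: measurable, bounded, vanishing off the window; a.e. convergence of the approximants
  have hHm : Measurable Hc := Complex.measurable_ofReal.comp (measurable_weilOddThetaVector a)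
  have hHB : ∀ t, ‖Hc t‖ ≤ B := fun t => by simpa [hHc, Complex.norm_real] using hB t
  have hH0 : ∀ t, t ∉ Icc (-a) a → Hc t = 0 := fun t ht => by
    simp [hHc, weilOddThetaVector_of_not_mem ht]
  have hnull : (volume : Measure ℝ) {-a, a} = 0 := (Set.toFinite _).measure_zero volume
  have hlim : ∀ᵐ t : ℝ, Tendsto (fun m => h m t) atTop (𝓝 (Hc t)) := by
    filter_upwards [measure_eq_zero_iff_ae_notMem.1 hnull] with t ht
    simp only [mem_insert_iff, mem_singleton_iff, not_or] at ht
    by_cases htI : t ∈ Ioo (-a) a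
    · exact hconv t htI
    · have htc : t ∉ Icc (-a) a := fun hm => by
        simp only [mem_Ioo, not_and_or, not_lt] at htI
        rcases htI with h1 | h1
        · exact ht.1 (le_antisymm h1 hm.1)
        · exact ht.2 (le_antisymm hm.2 h1)
      have h0 : ∀ m, h m t = 0 := fun m => by
        have := hdom m t
        rw [weilOddThetaVector_of_not_mem htc, abs_zero] at this
        exact norm_le_zero_iff.1 this
      rw [hH0 t htc]
      exact tendsto_const_nhds.congr fun m => (h0 m).symm
  -- the same data for the probe `i H`
  set Hi : ℝ → ℂ := fun t => I * Hc t with hHi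
  set hi : ℕ → ℝ → ℂ := fun m t => I * h m t with hhi
  have hhi_test : ∀ m, IsWeilTest (hi m) ∧ tsupport (hi m) ⊆ Icc (-a) a ∧ (∀ t, hi m (-t) = -hi m t) :=
    fun m => ⟨(hh m).1.const_mul I, tsupport_mul_subset_right.trans (hh m).2.1,
      fun t => by simp only [hhi, (hh m).2.2 t, mul_neg]⟩
  have hhiB : ∀ m t, ‖hi m t‖ ≤ B := fun m t => by
    simpa [hhi, norm_mul, Complex.norm_I] using hhB m t
  have hqi : ∀ m, (weilQuadratic (hi m)).re - ε * ∫ t, ‖hi m t‖ ^ 2 ≤ K₃ := fun m => by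
    have h1 : weilQuadratic (hi m) = weilQuadratic (h m) := by
      simp only [hhi, weilQuadratic_const_mul, Complex.normSq_I, Complex.ofReal_one, one_mul]
    have h2 : ∫ t, ‖hi m t‖ ^ 2 = ∫ t, ‖h m t‖ ^ 2 := by
      congr 1 with t; simp [hhi, Complex.norm_I]
    rw [h1, h2]; exact hq m
  have hHim : Measurable Hi := measurable_const.mul hHm
  have hHiB : ∀ t, ‖Hi t‖ ≤ B := fun t => by simpa [hHi, norm_mul, Complex.norm_I] using hHB t
  have hHi0 : ∀ t, t ∉ Icc (-a) a → Hi t = 0 := fun t ht => by simp [hHi, hH0 t ht]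
  have hlimi : ∀ᵐ t : ℝ, Tendsto (fun m => hi m t) atTop (𝓝 (Hi t)) := by
    filter_upwards [hlim] with t ht
    exact tendsto_const_nhds.mul ht
  -- per-`n` bound on `W(gₙ ⋆ H̃) − ε ∫ gₙ H̄`
  set A : ℕ → ℂ := fun n => weilFunctional (weilConv (g n) (weilReflect Hc)) with hA
  set P : ℕ → ℂ := fun n => ∫ t, g n t * conj (Hc t) with hP
  set qg : ℕ → ℝ := fun n => (weilQuadratic (g n)).re - ε * ∫ t, ‖g n t‖ ^ 2 with hqg
  have hre : ∀ n, |2 * ((A n).re - ε * (P n).re)| ≤ 2 * Real.sqrt (qg n) * Real.sqrt K₃ := fun n => by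
    have h1 := abs_polarDefect_limit_le (hg n).1 (hg n).2.1 (hg n).2.2.1 hHm hHB hH0 hh hhB hq hlim
    have e : (weilFunctional (weilConv (g n) (weilReflect Hc)) +
        conj (weilFunctional (weilConv (g n) (weilReflect Hc)))).re -
        2 * weilOddGroundEnergy a * (∫ t, g n t * conj (Hc t)).re = 2 * ((A n).re - ε * (P n).re) := by
      simp only [hA, hP, Complex.add_re, Complex.conj_re]; ring
    rwa [e] at h1
  have him : ∀ n, |2 * ((A n).im - ε * (P n).im)| ≤ 2 * Real.sqrt (qg n) * Real.sqrt K₃ := fun n => by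
    have h1 := abs_polarDefect_limit_le (hg n).1 (hg n).2.1 (hg n).2.2.1 hHim hHiB hHi0 hhi_test hhiB hqi hlimi
    have hW : weilFunctional (weilConv (g n) (weilReflect Hi)) = -I * A n := by
      simp only [hHi, hA]
      exact weilFunctional_weilConv_weilReflect_I_mul (g n) Hc
    have hPI : ∫ t, g n t * conj (Hi t) = -I * P n := by
      simp only [hHi, hP]
      exact integral_mul_conj_I_mul (g n) Hc
    rw [hW, hPI] at h1
    have e : (-I * A n + conj (-I * A n)).re - 2 * weilOddGroundEnergy a * (-I * P n).re =
        2 * ((A n).im - ε * (P n).im) := by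
      simp only [Complex.add_re, Complex.conj_re, Complex.mul_re, Complex.neg_re, Complex.neg_im,
        Complex.I_re, Complex.I_im]
      ring
    rwa [e] at h1
  have hnormle : ∀ n, ‖A n - (ε : ℂ) * P n‖ ≤ 2 * Real.sqrt (qg n) * Real.sqrt K₃ := fun n => by
    refine (Complex.norm_le_abs_re_add_abs_im _).trans ?_
    have e1 : (A n - (ε : ℂ) * P n).re = (A n).re - ε * (P n).re := by
      simp only [Complex.sub_re, Complex.re_ofReal_mul]
    have e2 : (A n - (ε : ℂ) * P n).im = (A n).im - ε * (P n).im := by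
      simp only [Complex.sub_im, Complex.im_ofReal_mul]
    rw [e1, e2]
    have h1 := hre n
    have h2 := him n
    rw [abs_mul, abs_of_pos (by norm_num : (0 : ℝ) < 2)] at h1 h2
    linarith
  -- `q(gₙ) → 0`, hence `A n − ε P n → 0`
  have hqg0 : Tendsto qg atTop (𝓝 0) := by
    have hfun : qg = fun n => (weilQuadratic (g n)).re - ε := by
      funext n; simp only [hqg, (hg n).2.2.2, mul_one]
    rw [hfun]
    have := hQ.sub_const ε
    rwa [sub_self] at this
  have hD : Tendsto (fun n => A n - (ε : ℂ) * P n) atTop (𝓝 0) := by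
    refine squeeze_zero_norm hnormle ?_
    have := (hqg0.sqrt.const_mul 2).mul_const (Real.sqrt K₃)
    simpa using this
  -- `P n → ∫ u H̄ = ∫ u H`
  have hHmem : MemLp Hc 2 volume := (memLp_weilOddThetaVector a 2).ofReal
  have hPlim : Tendsto P atTop (𝓝 (∫ t, u t * conj (Hc t))) :=
    ConnesVanSuijlekom.tendsto_integral_mul_conj_left hHmem hu
      (fun n => ConnesVanSuijlekom.isWeilTest_memLp (hg n).1) hL
  have hconj : (fun t => u t * conj (Hc t)) = fun t => u t * Hc t := by
    funext t; simp [hHc, Complex.conj_ofReal]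
  rw [hconj] at hPlim
  have hsum := hD.add (hPlim.const_mul (ε : ℂ))
  rw [zero_add] at hsum
  refine hsum.congr fun n => ?_
  simp only [hA]
  ring

end Summit.RiemannHypothesis.RiemannHypothesis.Theorems.OddBartaFloor

end
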